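import Literature.NumberTheory.LocalFields.PadicAlgebraOneUnitHomRigidity
import Literature.NumberTheory.EllipticCurves.SteinWuthrich2013.PadicExpLogCoshProofs
import HarnessLib

/-!
# `exp ∘ L = id` on one-units and `cosh((L u)²) = (u + u⁻¹)/2` in a complete ultrametric
# `ℚ_p`-algebra, for any logarithm `L` (Gouvêa 1993, Prop. 5.7.6–5.7.8; proofs only)

Topic `Literature/NumberTheory/LocalFields`, namespace `Literature.NumberTheory.LocalFields.PadicAlgebra`
(cell `bsd-eis`, seat `bsd-eis-k5-c4` g3). Field-generic form of
`SteinWuthrich2013/PadicExpLogCoshProofs.lean`: `F` is any complete normed field which is an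
ultrametric normed `ℚ_p`-algebra (`ℚ_p`, its finite extensions, `ℂ_p`), `p ≠ 2`, and the logarithm is
ANY function `L : F → F` which is additive on the ball `‖u − 1‖ ≤ p⁻¹` and tangent to `u − 1`
(`‖L(1+t) − t‖ ≤ 2‖t‖²`) — e.g. the logarithmic series. Needed for the Tate uniformisation over
`ℂ_p` at a non-split multiplicative prime (`SteinWuthrich2013.exists_isMultCanonical`).

* `expSeries_radius_ge`, `mem_ball_expSeries`, `exp_add_of_norm_le`, `hasSum_exp_of_norm_le`,
  `norm_exp_sub_one_sub_le`, `norm_exp_sub_one_le` — the exponential of `F` on `‖x‖ ≤ p⁻¹`;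
* `exp_log_eq_self` — **`exp(L υ) = υ`** on the ball, by multiplicative rigidity;
* `coshOfSq_log_sq` — **`coshOfSq((L υ)²) = (υ + υ⁻¹)/2`**.

## Sources
* F. Q. Gouvêa, *p-adic Numbers: An Introduction* (1993), §5.7. [Gouvea1993PadicNumbers]
* W. Stein, C. Wuthrich, Math. Comp. 82 (2013), §4.2. [SteinWuthrich2013]
-/

noncomputable section

open scoped Classical NNReal ENNReal Nat

open Filter Topology Literature.NumberTheory.Transcendental Literature.NumberTheory.EllipticCurves
  Literature.NumberTheory.EllipticCurves.SteinWuthrich2013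

namespace Literature.NumberTheory.LocalFields.PadicAlgebra

variable {p : ℕ} [hp : Fact p.Prime] {F : Type*} [NormedField F] [instF : NormedAlgebra ℚ_[p] F]
  [instU : IsUltrametricDist F] [CompleteSpace F]

include instF

omit instU [CompleteSpace F] in
/-- `‖(n!)⁻¹‖_F = p^{v_p(n!)}` in a normed `ℚ_p`-algebra. [cite: Gouvea1993PadicNumbers, §5.7 Lemma 5.7.4 (PDF p. 121)] -/
theorem norm_inv_factorial' (n : ℕ) : ‖((n ! : ℕ) : F)⁻¹‖ = (p : ℝ) ^ (padicValNat p n ! : ℤ) := by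
  rw [norm_inv, IwasawaLog.norm_natCast p, ← norm_inv]
  exact SteinWuthrich2013.norm_inv_factorial n

omit instF [CompleteSpace F] in
/-- One-units have norm one. [folklore] [cite: Gouvea1993PadicNumbers, §5.7 Prop. 5.7.8 (PDF p. 124)] -/
theorem norm_eq_one_of_norm_sub_one_le {v : F} (hv : ‖v - 1‖ ≤ (p : ℝ)⁻¹) : ‖v‖ = 1 := by
  have hp1 : (p : ℝ)⁻¹ < 1 := inv_lt_one_of_one_lt₀ (by exact_mod_cast hp.out.one_lt)
  have hv' := hv.trans_lt hp1
  have := IsUltrametricDist.norm_add_eq_max_of_norm_ne_norm (x := v - 1) (y := (1 : F))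
    (by rw [norm_one]; exact hv'.ne)
  rw [sub_add_cancel, norm_one, max_eq_right hv'.le] at this
  exact this

omit instU [CompleteSpace F] in
/-- **The exponential series of `F` converges on `‖x‖ < (√p)⁻¹`** (`p ≠ 2`): its radius is
`≥ (√p)⁻¹`, since `‖xⁿ/n!‖ ≤ ((√p)⁻¹)ⁿ p^{v_p(n!)} ≤ 1` by `2v_p(n!) ≤ n` (Gouvêa Prop. 5.7.6 gives the
exact radius `p^{−1/(p−1)} ≥ (√p)⁻¹`). [cite: Gouvea1993PadicNumbers, §5.7 Prop. 5.7.6 (PDF p. 122)] -/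
theorem expSeries_radius_ge (hp2 : p ≠ 2) :
    (((Real.toNNReal (Real.sqrt (p : ℝ)))⁻¹ : ℝ≥0) : ℝ≥0∞) ≤
      (NormedSpace.expSeries ℚ_[p] F).radius := by
  have hp0 : (0 : ℝ) < p := by exact_mod_cast hp.out.pos
  have hsq : 0 < Real.sqrt p := Real.sqrt_pos.mpr hp0
  refine FormalMultilinearSeries.le_radius_of_bound _ 1 fun n => ?_
  have hcoe : (((Real.toNNReal (Real.sqrt (p : ℝ)))⁻¹ : ℝ≥0) : ℝ) = (Real.sqrt p)⁻¹ := by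
    rw [NNReal.coe_inv, Real.coe_toNNReal _ hsq.le]
  rw [hcoe]
  have hnorm : ‖NormedSpace.expSeries ℚ_[p] F n‖ ≤ (p : ℝ) ^ (padicValNat p n ! : ℤ) := by
    unfold NormedSpace.expSeries
    rw [norm_smul, ContinuousMultilinearMap.norm_mkPiAlgebraFin, mul_one, ← SteinWuthrich2013.norm_inv_factorial n]
  calc ‖NormedSpace.expSeries ℚ_[p] F n‖ * ((Real.sqrt p)⁻¹) ^ n
      ≤ (p : ℝ) ^ (padicValNat p n ! : ℤ) * ((Real.sqrt p)⁻¹) ^ n :=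
        mul_le_mul_of_nonneg_right hnorm (pow_nonneg (inv_nonneg.mpr hsq.le) n)
    _ ≤ 1 := by
        -- `p^{v} ≤ (√p)^n` since `p^{2v} ≤ p^n`
        rw [inv_pow, ← div_eq_mul_inv, div_le_one (pow_pos hsq n), zpow_natCast]
        have h2v := two_mul_padicValNat_factorial_le hp2 n
        calc (p : ℝ) ^ padicValNat p n ! = (Real.sqrt p) ^ (2 * padicValNat p n !) := by
              rw [pow_mul, Real.sq_sqrt hp0.le]
          _ ≤ (Real.sqrt p) ^ n :=
              pow_le_pow_right₀ (Real.one_le_sqrt.mpr (by exact_mod_cast hp.out.one_lt.le)) h2v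

omit instU [CompleteSpace F] in
/-- A one-unit's worth: `‖x‖ ≤ p⁻¹` puts `x` in the ball of convergence of `exp_p` (`p ≠ 2`).
[cite: Gouvea1993PadicNumbers, §5.7 Prop. 5.7.6 (PDF p. 122)] -/
theorem mem_ball_expSeries (hp2 : p ≠ 2) {x : F} (hx : ‖x‖ ≤ (p : ℝ)⁻¹) :
    x ∈ Metric.eball (0 : F) (NormedSpace.expSeries ℚ_[p] F).radius := by
  have hp0 : (0 : ℝ) < p := by exact_mod_cast hp.out.pos
  have hp1 : (1 : ℝ) < p := by exact_mod_cast hp.out.one_lt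
  have hsq : 0 < Real.sqrt p := Real.sqrt_pos.mpr hp0
  have hlt : ‖x‖ < (Real.sqrt p)⁻¹ := by
    refine hx.trans_lt ?_
    rw [inv_lt_inv₀ hp0 hsq]
    calc Real.sqrt p < Real.sqrt p * Real.sqrt p := by
          have h1 : 1 < Real.sqrt p := by
            rw [show (1 : ℝ) = Real.sqrt 1 from Real.sqrt_one.symm]
            exact Real.sqrt_lt_sqrt zero_le_one hp1
          exact lt_mul_of_one_lt_right hsq h1
      _ = p := Real.mul_self_sqrt hp0.le
  rw [Metric.mem_eball, edist_zero_right, enorm_eq_nnnorm]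
  have : (‖x‖₊ : ℝ≥0) < (Real.toNNReal (Real.sqrt (p : ℝ)))⁻¹ := by
    rw [← NNReal.coe_lt_coe, NNReal.coe_inv, Real.coe_toNNReal _ hsq.le, coe_nnnorm]
    exact hlt
  exact lt_of_lt_of_le (ENNReal.coe_lt_coe.mpr this) (expSeries_radius_ge hp2)

omit instU in
/-- **`exp_p(x + y) = exp_p(x) exp_p(y)`** for `‖x‖, ‖y‖ ≤ p⁻¹`, `p ≠ 2` (Gouvêa Prop. 5.7.7; Mathlib
`NormedSpace.exp_add_of_mem_ball`). [cite: Gouvea1993PadicNumbers, §5.7 Prop. 5.7.7 (PDF p. 123)] -/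
theorem exp_add_of_norm_le (hp2 : p ≠ 2) {x y : F} (hx : ‖x‖ ≤ (p : ℝ)⁻¹)
    (hy : ‖y‖ ≤ (p : ℝ)⁻¹) :
    NormedSpace.exp (x + y) = NormedSpace.exp x * NormedSpace.exp y :=
  NormedSpace.exp_add_of_mem_ball (𝕂 := ℚ_[p]) (mem_ball_expSeries hp2 hx) (mem_ball_expSeries hp2 hy)

omit instU in
/-- `HasSum (xⁿ/n!) (exp_p x)` for `‖x‖ ≤ p⁻¹`, `p ≠ 2`. [cite: Gouvea1993PadicNumbers, §5.7 Prop. 5.7.6 (PDF p. 122)] -/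
theorem hasSum_exp_of_norm_le (hp2 : p ≠ 2) {x : F} (hx : ‖x‖ ≤ (p : ℝ)⁻¹) :
    HasSum (fun n : ℕ => ((n ! : ℕ) : F)⁻¹ * x ^ n) (NormedSpace.exp x) := by
  have h := NormedSpace.expSeries_hasSum_exp_of_mem_ball' (𝕂 := ℚ_[p]) x (mem_ball_expSeries hp2 hx)
  refine h.congr_fun fun n => ?_
  rw [Algebra.smul_def, map_inv₀, map_natCast]

omit instU [CompleteSpace F] in
/-- The general term: `‖xⁿ/n!‖ ≤ ‖x‖²` for `n ≥ 2` and `‖xⁿ/n!‖ ≤ ‖x‖` for `n ≥ 1`, when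
`‖x‖ ≤ p⁻¹`, `p ≠ 2` (`v_p(n!) ≤ n − 2`). [cite: Gouvea1993PadicNumbers, §5.7 Lemma 5.7.4 (PDF p. 121)] -/
theorem norm_exp_term_le (hp2 : p ≠ 2) {x : F} (hx : ‖x‖ ≤ (p : ℝ)⁻¹) {n : ℕ} (hn : 2 ≤ n) :
    ‖((n ! : ℕ) : F)⁻¹ * x ^ n‖ ≤ ‖x‖ ^ 2 := by
  have hp0 : (0 : ℝ) < p := by exact_mod_cast hp.out.pos
  have hp1 : (1 : ℝ) ≤ p := by exact_mod_cast hp.out.one_lt.le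
  rw [norm_mul, norm_pow, norm_inv_factorial' (p := p), zpow_natCast]
  have hv := padicValNat_factorial_le_sub_two hp2 hn
  obtain ⟨m, rfl⟩ : ∃ m, n = m + 2 := ⟨n - 2, by omega⟩
  have hv' : padicValNat p (m + 2)! ≤ m := by omega
  calc (p : ℝ) ^ padicValNat p (m + 2)! * ‖x‖ ^ (m + 2)
      ≤ (p : ℝ) ^ m * ‖x‖ ^ (m + 2) :=
        mul_le_mul_of_nonneg_right (pow_le_pow_right₀ hp1 hv') (pow_nonneg (norm_nonneg _) _)
    _ = ((p : ℝ) * ‖x‖) ^ m * ‖x‖ ^ 2 := by ring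
    _ ≤ 1 * ‖x‖ ^ 2 := by
        refine mul_le_mul_of_nonneg_right (pow_le_one₀ (mul_nonneg hp0.le (norm_nonneg _)) ?_)
          (sq_nonneg _)
        calc (p : ℝ) * ‖x‖ ≤ (p : ℝ) * (p : ℝ)⁻¹ := mul_le_mul_of_nonneg_left hx hp0.le
          _ = 1 := mul_inv_cancel₀ hp0.ne'
    _ = ‖x‖ ^ 2 := one_mul _

/-- **`‖exp_p x − 1 − x‖ ≤ ‖x‖²`** for `‖x‖ ≤ p⁻¹`, `p ≠ 2`. [Gouvêa 1993, §5.7 (Prop. 5.7.8, proof)]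
[cite: Gouvea1993PadicNumbers, §5.7 Prop. 5.7.8 (PDF p. 124)] -/
theorem norm_exp_sub_one_sub_le (hp2 : p ≠ 2) {x : F} (hx : ‖x‖ ≤ (p : ℝ)⁻¹) :
    ‖NormedSpace.exp x - 1 - x‖ ≤ ‖x‖ ^ 2 := by
  have h := hasSum_exp_of_norm_le hp2 hx
  have hS := h.summable
  have hsplit : NormedSpace.exp x = 1 + x + ∑' n : ℕ, ((((n + 2) ! : ℕ) : F)⁻¹ * x ^ (n + 2)) := by
    rw [← h.tsum_eq, hS.tsum_eq_zero_add, (summable_nat_add_iff 1 |>.mpr hS).tsum_eq_zero_add]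
    simp only [Nat.factorial_zero, Nat.cast_one, inv_one, pow_zero, mul_one, zero_add,
      Nat.factorial_one, pow_one, one_mul]
    rw [← add_assoc]
  rw [hsplit, show (1 : F) + x + _ - 1 - x = ∑' n : ℕ, ((((n + 2) ! : ℕ) : F)⁻¹ * x ^ (n + 2))
    by ring]
  exact IsUltrametricDist.norm_tsum_le_of_forall_le_of_nonneg (sq_nonneg _)
    fun n => norm_exp_term_le hp2 hx (by omega)

/-- **`‖exp_p x − 1‖ ≤ ‖x‖`** for `‖x‖ ≤ p⁻¹`, `p ≠ 2` ("`exp_p(x)` is in the domain of `log_p`",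
Gouvêa Prop. 5.7.8). [cite: Gouvea1993PadicNumbers, §5.7 Prop. 5.7.8 (PDF p. 124)] -/
theorem norm_exp_sub_one_le (hp2 : p ≠ 2) {x : F} (hx : ‖x‖ ≤ (p : ℝ)⁻¹) :
    ‖NormedSpace.exp x - 1‖ ≤ ‖x‖ := by
  have hp1 : (p : ℝ)⁻¹ ≤ 1 := inv_le_one_of_one_le₀ (by exact_mod_cast hp.out.one_lt.le)
  have e : NormedSpace.exp x - 1 = (NormedSpace.exp x - 1 - x) + x := by ring
  rw [e]
  refine (IsUltrametricDist.norm_add_le_max _ _).trans (max_le ?_ le_rfl)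
  refine (norm_exp_sub_one_sub_le hp2 hx).trans ?_
  calc ‖x‖ ^ 2 = ‖x‖ * ‖x‖ := sq _
    _ ≤ ‖x‖ * 1 := mul_le_mul_of_nonneg_left (hx.trans hp1) (norm_nonneg _)
    _ = ‖x‖ := mul_one _

/-! ### `exp_p ∘ log_p = id` on one-units -/

omit instF [CompleteSpace F] in
/-- `‖L v‖ ≤ ‖v − 1‖` on the ball for a logarithm tangent to `t` (`‖L(1+t) − t‖ ≤ 2‖t‖²`, `p ≠ 2`).
[cite: Gouvea1993PadicNumbers, §5.7 Prop. 5.7.8 (PDF p. 124)] -/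
theorem norm_log_le (hp2 : p ≠ 2) {Lg : F → F}
    (htan : ∀ t : F, ‖t‖ ≤ (p : ℝ)⁻¹ → ‖Lg (1 + t) - t‖ ≤ 2 * ‖t‖ ^ 2)
    {v : F} (hv : ‖v - 1‖ ≤ (p : ℝ)⁻¹) : ‖Lg v‖ ≤ ‖v - 1‖ := by
  have hp0 : (0 : ℝ) < p := by exact_mod_cast hp.out.pos
  set t := v - 1 with htdef
  have hvt : v = 1 + t := by rw [htdef]; ring
  have hLt : ‖Lg v - t‖ ≤ 2 * ‖t‖ ^ 2 := by rw [hvt]; exact htan t hv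
  have e : Lg v = (Lg v - t) + t := by ring
  rw [e]
  refine (IsUltrametricDist.norm_add_le_max _ _).trans (max_le (hLt.trans ?_) le_rfl)
  calc 2 * ‖t‖ ^ 2 = (2 * ‖t‖) * ‖t‖ := by ring
    _ ≤ 1 * ‖t‖ := by
        refine mul_le_mul_of_nonneg_right ?_ (norm_nonneg _)
        have hp3 : (3 : ℝ) ≤ p := by
          have := hp.out.two_le
          exact_mod_cast (show 3 ≤ p by omega)
        calc 2 * ‖t‖ ≤ 2 * (p : ℝ)⁻¹ := by gcongr
          _ ≤ 1 := by
              rw [mul_inv_le_iff₀ hp0]; linarith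
    _ = ‖t‖ := one_mul _

/-- **`exp(L υ) = υ` on the ball `‖υ − 1‖ ≤ p⁻¹` (`p ≠ 2`) for ANY logarithm `L`**, i.e. any
`L : F → F` with `L(uv) = L(u) + L(v)` on the ball and `‖L(1+t) − t‖ ≤ 2‖t‖²` (Gouvêa Prop. 5.7.8
for `ℚ_p`; here in any complete ultrametric normed `ℚ_p`-algebra field). Proof by rigidity:
`R(υ) = exp(L υ) · υ⁻¹` is multiplicative on the ball with `‖R(1+t) − 1‖ ≤ 2‖t‖²`, hence `R ≡ 1`
(`PadicAlgebra.eq_one_of_mul_hom_of_norm_sub_one_le_sq`). [Gouvêa 1993, Prop. 5.7.8]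
[cite: Gouvea1993PadicNumbers, §5.7 Prop. 5.7.8 (PDF p. 124)] -/
theorem exp_log_eq_self (hp2 : p ≠ 2) {Lg : F → F}
    (hLmul : ∀ u v : F, ‖u - 1‖ ≤ (p : ℝ)⁻¹ → ‖v - 1‖ ≤ (p : ℝ)⁻¹ → Lg (u * v) = Lg u + Lg v)
    (htan : ∀ t : F, ‖t‖ ≤ (p : ℝ)⁻¹ → ‖Lg (1 + t) - t‖ ≤ 2 * ‖t‖ ^ 2)
    {υ : F} (hυ : ‖υ - 1‖ ≤ (p : ℝ)⁻¹) : NormedSpace.exp (Lg υ) = υ := by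
  have hp0 : (0 : ℝ) < p := by exact_mod_cast hp.out.pos
  have hpinv1 : (p : ℝ)⁻¹ ≤ 1 := inv_le_one_of_one_le₀ (by exact_mod_cast hp.out.one_lt.le)
  -- facts on the ball
  have hne0 : ∀ {v : F}, ‖v - 1‖ ≤ (p : ℝ)⁻¹ → v ≠ 0 := fun hv h0 => by
    have := norm_eq_one_of_norm_sub_one_le (p := p) hv; rw [h0, norm_zero] at this
    exact zero_ne_one this
  have hlog : ∀ {v : F}, ‖v - 1‖ ≤ (p : ℝ)⁻¹ → ‖Lg v‖ ≤ (p : ℝ)⁻¹ := fun hv =>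
    (norm_log_le hp2 htan hv).trans hv
  set R : F → F := fun v => NormedSpace.exp (Lg v) * v⁻¹ with hRdef
  have hmul : ∀ v w : F, ‖v - 1‖ ≤ (p : ℝ)⁻¹ → ‖w - 1‖ ≤ (p : ℝ)⁻¹ → R (v * w) = R v * R w := by
    intro v w hv hw
    simp only [hRdef]
    rw [hLmul v w hv hw, exp_add_of_norm_le hp2 (hlog hv) (hlog hw), mul_inv]
    ring
  have hbd : ∀ v : F, ‖v - 1‖ ≤ (p : ℝ)⁻¹ → ‖R v - 1‖ ≤ 2 * ‖v - 1‖ ^ 2 := by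
    intro v hv
    have hv1 : ‖v‖ = 1 := norm_eq_one_of_norm_sub_one_le (p := p) hv
    have hv0 : v ≠ 0 := hne0 hv
    set t := v - 1 with htdef
    have hvt : v = 1 + t := by rw [htdef]; ring
    set L := Lg v with hLdef
    have hLt : ‖L - t‖ ≤ 2 * ‖t‖ ^ 2 := by rw [hLdef, hvt]; exact htan t hv
    have hL : ‖L‖ ≤ (p : ℝ)⁻¹ := hlog hv
    have hE : ‖NormedSpace.exp L - 1 - L‖ ≤ ‖L‖ ^ 2 := norm_exp_sub_one_sub_le hp2 hL
    -- `‖L‖ ≤ ‖t‖`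
    have hLn : ‖L‖ ≤ ‖t‖ := by rw [hLdef]; exact norm_log_le hp2 htan hv
    -- `R v − 1 = (exp L − v)/v`, `‖v‖ = 1`
    have e : R v - 1 = (NormedSpace.exp L - 1 - L + (L - t)) * v⁻¹ := by
      have e1 : NormedSpace.exp L - 1 - L + (L - t) = NormedSpace.exp L - v := by rw [hvt]; ring
      rw [e1]
      show NormedSpace.exp (Lg v) * v⁻¹ - 1 = _
      rw [← hLdef]
      field_simp
    rw [e, norm_mul, norm_inv, hv1, inv_one, mul_one]
    refine (IsUltrametricDist.norm_add_le_max _ _).trans (max_le (hE.trans ?_) hLt)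
    calc ‖L‖ ^ 2 ≤ ‖t‖ ^ 2 := by gcongr
      _ ≤ 2 * ‖t‖ ^ 2 := by nlinarith [sq_nonneg ‖t‖]
  have hone : ∀ v : F, ‖v - 1‖ ≤ (p : ℝ)⁻¹ → ‖R v - 1‖ ≤ (p : ℝ)⁻¹ := by
    intro v hv
    refine (hbd v hv).trans ?_
    calc 2 * ‖v - 1‖ ^ 2 ≤ 2 * ((p : ℝ)⁻¹) ^ 2 := by gcongr
      _ = (2 * (p : ℝ)⁻¹) * (p : ℝ)⁻¹ := by ring
      _ ≤ 1 * (p : ℝ)⁻¹ := by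
          refine mul_le_mul_of_nonneg_right ?_ (inv_nonneg.mpr hp0.le)
          have hp3 : (3 : ℝ) ≤ p := by
            have := hp.out.two_le
            exact_mod_cast (show 3 ≤ p by omega)
          rw [mul_inv_le_iff₀ hp0]; linarith
      _ = (p : ℝ)⁻¹ := one_mul _
  have hR := PadicAlgebra.eq_one_of_mul_hom_of_norm_sub_one_le_sq hp2 R 2 hmul hone hbd hυ
  have hυ0 : υ ≠ 0 := hne0 hυ
  have : NormedSpace.exp (Lg υ) * υ⁻¹ = 1 := hR
  calc NormedSpace.exp (Lg υ) = (NormedSpace.exp (Lg υ) * υ⁻¹) * υ := by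
        field_simp
    _ = υ := by rw [this, one_mul]

/-! ### `cosh (log_p υ) = (υ + υ⁻¹)/2` -/

/-- **`coshOfSq ((L υ)²) = (υ + υ⁻¹)/2` for one-units `υ` (`‖υ − 1‖ ≤ p⁻¹`, `p ≠ 2`) and any logarithm `L`**:
`Σ_n L^{2n}/(2n)! = (exp_p L + exp_p(−L))/2` (even/odd splitting of the exponential series,
Mathlib `HasSum.even_add_odd`) with `L = log_p υ`, `exp_p L = υ`, `exp_p(−L) = exp_p(log_p υ⁻¹) = υ⁻¹`
(Prop. 5.7.8). This is the identity behind SW's "`(u−1)²/u = u + u⁻¹ − 2`" transcription of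
`σ_p(u)` through `cosh(log_p u)`. [Gouvêa 1993, Prop. 5.7.8; Stein–Wuthrich 2013, §4.2]
[cite: Gouvea1993PadicNumbers, §5.7 Prop. 5.7.8 (PDF p. 124)] [cite: SteinWuthrich2013, §4.2 (p. 15)] -/
theorem coshOfSq_log_sq (hp2 : p ≠ 2) {Lg : F → F}
    (hLmul : ∀ u v : F, ‖u - 1‖ ≤ (p : ℝ)⁻¹ → ‖v - 1‖ ≤ (p : ℝ)⁻¹ → Lg (u * v) = Lg u + Lg v)
    (htan : ∀ t : F, ‖t‖ ≤ (p : ℝ)⁻¹ → ‖Lg (1 + t) - t‖ ≤ 2 * ‖t‖ ^ 2)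
    {υ : F} (hυ : ‖υ - 1‖ ≤ (p : ℝ)⁻¹) :
    coshOfSq (Lg υ ^ 2) = (υ + υ⁻¹) / 2 := by
  have hp0' : (0 : ℝ) ≤ (p : ℝ)⁻¹ := inv_nonneg.mpr (by positivity)
  have hυ1 : ‖υ‖ = 1 := norm_eq_one_of_norm_sub_one_le (p := p) hυ
  have hυ0 : υ ≠ 0 := by intro h0; rw [h0, norm_zero] at hυ1; exact zero_ne_one hυ1
  set L := Lg υ with hLdef
  have hL : ‖L‖ ≤ (p : ℝ)⁻¹ := (norm_log_le hp2 htan hυ).trans hυ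
  have hnL : ‖-L‖ ≤ (p : ℝ)⁻¹ := by rw [norm_neg]; exact hL
  -- `exp L = υ`, `exp (−L) = υ⁻¹`
  have hEL : NormedSpace.exp L = υ := exp_log_eq_self hp2 hLmul htan hυ
  have hinv1 : ‖υ⁻¹ - 1‖ ≤ (p : ℝ)⁻¹ := by
    have e : υ⁻¹ - 1 = -(υ⁻¹ * (υ - 1)) := by field_simp; ring
    rw [e, norm_neg, norm_mul, norm_inv, hυ1, inv_one, one_mul]
    exact hυ
  have hone1 : ‖(1 : F) - 1‖ ≤ (p : ℝ)⁻¹ := by rw [sub_self, norm_zero]; exact hp0'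
  have hLinv : Lg υ⁻¹ = -L := by
    have h := hLmul υ υ⁻¹ hυ hinv1
    rw [mul_inv_cancel₀ hυ0] at h
    have h1 : Lg (1 : F) = 0 := by
      have h11 := hLmul 1 1 hone1 hone1
      rw [mul_one] at h11; linear_combination -h11
    rw [h1] at h
    linear_combination -h
  have hEnL : NormedSpace.exp (-L) = υ⁻¹ := by
    rw [← hLinv]; exact exp_log_eq_self hp2 hLmul htan hinv1
  -- even/odd splitting
  have hsumL := hasSum_exp_of_norm_le hp2 hL
  have hsumnL := hasSum_exp_of_norm_le hp2 hnL
  have hsum : HasSum (fun n : ℕ => ((n ! : ℕ) : F)⁻¹ * (L ^ n + (-L) ^ n)) (υ + υ⁻¹) := by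
    have e : υ + υ⁻¹ = NormedSpace.exp L + NormedSpace.exp (-L) := by rw [hEL, hEnL]
    have hfun : (fun n : ℕ => ((n ! : ℕ) : F)⁻¹ * (L ^ n + (-L) ^ n)) =
        fun n : ℕ => ((n ! : ℕ) : F)⁻¹ * L ^ n + ((n ! : ℕ) : F)⁻¹ * (-L) ^ n := by
      funext n; ring
    rw [e, hfun]
    exact hsumL.add hsumnL
  -- the even part
  have heven : HasSum (fun k : ℕ => (((2 * k) ! : ℕ) : F)⁻¹ * (L ^ (2 * k) + (-L) ^ (2 * k)))
      (2 * coshOfSq (L ^ 2)) := by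
    have h2 : Summable fun k : ℕ => ((((2 * k) ! : ℕ) : F)⁻¹ * L ^ (2 * k)) :=
      hsumL.summable.comp_injective (mul_right_injective₀ (two_ne_zero' ℕ))
    have hfun1 : (fun k : ℕ => (L ^ 2) ^ k / (((2 * k) ! : ℕ) : F)) =
        fun k : ℕ => ((((2 * k) ! : ℕ) : F)⁻¹ * L ^ (2 * k)) := by
      funext k; rw [← pow_mul, div_eq_inv_mul]
    have hco : HasSum (fun k : ℕ => (L ^ 2) ^ k / (((2 * k) ! : ℕ) : F)) (coshOfSq (L ^ 2)) := by
      have hs : Summable fun k : ℕ => (L ^ 2) ^ k / (((2 * k) ! : ℕ) : F) := by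
        rw [hfun1]; exact h2
      unfold coshOfSq
      exact hs.hasSum
    have hfun2 : (fun k : ℕ => (((2 * k) ! : ℕ) : F)⁻¹ * (L ^ (2 * k) + (-L) ^ (2 * k))) =
        fun k : ℕ => 2 * ((L ^ 2) ^ k / (((2 * k) ! : ℕ) : F)) := by
      funext k
      rw [Even.neg_pow (even_two_mul k), ← pow_mul, div_eq_inv_mul]
      ring
    rw [hfun2]
    exact hco.mul_left 2
  -- the odd part vanishes
  have hodd : HasSum (fun k : ℕ => (((2 * k + 1) ! : ℕ) : F)⁻¹ *
      (L ^ (2 * k + 1) + (-L) ^ (2 * k + 1))) 0 := by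
    have hfun3 : (fun k : ℕ => (((2 * k + 1) ! : ℕ) : F)⁻¹ *
        (L ^ (2 * k + 1) + (-L) ^ (2 * k + 1))) = fun _ => 0 := by
      funext k
      rw [Odd.neg_pow ⟨k, rfl⟩, add_neg_cancel, mul_zero]
    rw [hfun3]
    exact hasSum_zero
  have hall := HasSum.even_add_odd (f := fun n : ℕ => ((n ! : ℕ) : F)⁻¹ * (L ^ n + (-L) ^ n))
    heven hodd
  rw [add_zero] at hall
  have huniq := hsum.unique hall
  have h2 : (2 : F) ≠ 0 := by
    have h := norm_two_eq_one (p := p) (F := F) hp2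
    intro h0; rw [h0, norm_zero] at h; exact zero_ne_one h
  rw [huniq]
  field_simp


end Literature.NumberTheory.LocalFields.PadicAlgebra

end
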